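import Summits.QuantumFields.GaugeBoot.Rows.KZL2rpD4PairR
import HarnessLib

/-!
# Gauge-boot: kernel check of the link pair classes, part 2/2

Cell `pub-gaugeboot` (HOME `run/shared/lean/pub/pub-gaugeboot/`), seat lean1 (SYMMETRY-FACTORISED torus layer for the kz-L2-rp-4D family =
rows C91–C106 / C123–C127; label set, lines, irrep data, pair/row class certification, orbit tables, reduction identity, assembly).

HONEST FRAMING (page 1 of every file of this cell): certified bounds on lattice expectations at STATED coupling,
gauge group, dimension and torus size; NOT a mass gap, NOT a continuum limit, NOT a string tension, NOT large `N`.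
The venture is explicitly NOT Yang–Mills-summit-bearing (barriers `FixedCouplingUltralocality`,
`PerturbativeInvisibility`).

`PLOK q` for `q` in ranges (nested shallow ranges of 64), each one closed computation (`decide +kernel`); assembled in `KZL2rpD4PairAsm`.
-/

noncomputable section

open Literature.MathematicalPhysics.QuantumFieldTheory

namespace Summit.QuantumFields.GaugeBoot

namespace KZL2rpD4

set_option maxHeartbeats 0 in
/-- Pairs `4608 ≤ q < 5760` canonicalise (1152 entries; kernel). -/
theorem plcanon_4608_5760 : ∀ x : Fin 18, ∀ z : Fin 64, 4608 + 64 * x.val + z.val < 5760 → PLOK (4608 + 64 * x.val + z.val) := by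
  decide +kernel

set_option maxHeartbeats 0 in
/-- Pairs `5760 ≤ q < 6912` canonicalise (1152 entries; kernel). -/
theorem plcanon_5760_6912 : ∀ x : Fin 18, ∀ z : Fin 64, 5760 + 64 * x.val + z.val < 6912 → PLOK (5760 + 64 * x.val + z.val) := by
  decide +kernel

set_option maxHeartbeats 0 in
/-- Pairs `6912 ≤ q < 8064` canonicalise (1152 entries; kernel). -/
theorem plcanon_6912_8064 : ∀ x : Fin 18, ∀ z : Fin 64, 6912 + 64 * x.val + z.val < 8064 → PLOK (6912 + 64 * x.val + z.val) := by
  decide +kernel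

set_option maxHeartbeats 0 in
/-- Pairs `8064 ≤ q < 8612` canonicalise (548 entries; kernel). -/
theorem plcanon_8064_8612 : ∀ x : Fin 9, ∀ z : Fin 64, 8064 + 64 * x.val + z.val < 8612 → PLOK (8064 + 64 * x.val + z.val) := by
  decide +kernel

end KZL2rpD4

end Summit.QuantumFields.GaugeBoot

end
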